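import Literature.MathematicalPhysics.QuantumFieldTheory.MullerSchiemann1987.MS87HeatKernelComplex
import HarnessLib

/-!
# Müller–Schiemann, *Continuum limit of a hierarchical SU(2) lattice gauge theory in 4 dimensions*
# (CMP 110, 1987), (6.16) OF THE PROOF OF THEOREM 2 PART 4) (p.281 L.36 – p.282 L.2) FOR THE HEAT-KERNEL ACTION AT THE
# INITIAL SCALE: `|h_HK(x + iy)| ≤ exp{(1 + ε′)(κ/2)²β^{1−2α}}` for `|x| ≤ π`, `|y| < (κ/2)β^{−α}`, `γ` large
# (`β = γ − 1/6 + ρ₁(γ)`) — PROVED from the tree's Lemma (iv) (large angles) and (A.10) on `ℂ` (small angles)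
# (theorems only; no definition, no named fact)

statement-level skeleton of published theorems with citation tags; proofs where landed; nothing here is a claim about the Yang–Mills mass gap

[MullerSchiemann1987] V. F. Müller, J. Schiemann, Commun. Math. Phys. **110** (1987) 261–286, Sect. 6 p.281 L.35 – p.282 L.2,
(6.16); Theorem 2 parts 2)–4) p.281; Appendix pp.284–285, Lemma (iv) and (A.10). Read by this seat on its own 3× page
renders of the journal scan (`renders-cmp110ms/`, pp.281–282 = PDF 21–22, pp.284–285 = PDF 24–25). Lean lane of the
lit-balaban YM LIT SWEEP CONTEXT row X1 (register `MullerSchiemann1987/`); the model is the `d = 4` HIERARCHICAL `SU(2)`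
gauge model (Migdal's recursion), NOT lattice Yang–Mills. Companion of `MS87WilsonStripBound` ((6.16) for the Wilson
action at the initial scale) and of `MS87NormalFamilyBound` ((6.16)–(6.18) with Theorem 2 parts 2), 3) as hypotheses);
consumes the tree's `HeatKernel.lemma_iv` (Appendix Lemma (iv) on the complex strip, = Theorem 2 part 3) for (HK) at the
initial scale) and `HeatKernel.norm_hC_le_exp_A10` ((A.10) on `ℂ`: `|h(θ)| ≤ exp{−γRe θ² + 𝒪(1)}`).

**What the paper prints (p.281 L.35 – p.282 L.2).** *«In order to prove 4) we first observe for given cutoff N and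
scale n the bound, valid for |y| < (κ/2)(β_N^{(−n)})^{−α}, |h_N^{(−n)}(x + iy)| < exp{(1 + ε′)(κ/2)²(β_N^{(−n)})^{1−2α}}.
(6.16) It follows from 2), 3) and the periodicity of h_N^{(−n)}(z); the small ε′ > 0 absorbs an order
𝒪((β_N^{(−n)})^{−2α}).»* For the heat-kernel action at the initial scale `n = N` (Theorem 2: «or by the heat kernel
action (2.20) with γ = B_N + 1/6»; p.281: «HK: β_N^{(−N)} = γ − 1/6 + 𝒪(γ³e^{−4π²γ})», the tree's `betaIV γ = γ − 1/6 +
ρ₁(γ)`).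

**What this file proves (kernel-checked, 0 sorry, standard axioms; theorems only, no definition, no named fact).**
**`eq616_heatKernel`**: for `0 < α < ½`, `κ² < 3/2` and any `ε′ > 0` there is `γ₀` such that for all `γ ≥ γ₀`, with
`β = betaIV γ`, all real `x, y` with `|x| ≤ π`, `|y| < (κ/2)β^{−α}`:
`‖h_HK(x + iy)‖ ≤ exp{(1 + ε′)(κ/2)²β^{1−2α}}` (`h_HK = HeatKernel.hC γ`, the entire continuation (A.1)/(2.21)).
Route, exactly the print's «from 2), 3)»: for `|x + iy| > β^{−α}` Lemma (iv) gives `exp{βy² − ⅝β^{1−2α}} ≤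
exp{(κ/2)²β^{1−2α}}`; for `|x + iy| ≤ β^{−α}` (then `|x| ≤ π/2`) (A.10) gives `exp{γy² + A}` with
`γ = β + 1/6 − ρ₁ ≤ β + 7/6` once `|ρ₁| ≤ 1`, i.e. `exp{(κ/2)²β^{1−2α} + (7/6)(κ/2)² + A}`, and «the small ε′ absorbs»
the constant once `(7/6)(κ/2)² + A ≤ ε′(κ/2)²β^{1−2α}` — all three thresholds are eventual in `γ` (`betaIV → ∞`,
`ρ₁ → 0`).

**Readings / scope (declared).** (i) Only the initial-scale member `n = N` of the family (later scales need Theorem 1).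
(ii) In the small-angle regime the print invokes part 2) (= (A₃) for `h_N^{(−N)}`); the tree's (A₃) for the heat kernel
is real-axis only (`HeatKernelSU2`, Lemma (iii)), so this file uses the tree's complex (A.10) instead — the absorbed
constant is `𝒪(1)` rather than `𝒪(β^{−2α})`, which the print's «small ε′» absorbs all the same for `β` large.
(iii) `γ₀` is obtained from filters (`∀ᶠ γ in atTop`), not computed.

**Not claimed.** Theorem 2 part 4) itself (Montel; sibling `MS87Theorem3CommonSubsequence`), (6.16) at scales `n < N`,
(A₃) for the heat kernel on `ℂ`, Theorem 1, anything about lattice Yang–Mills or the Clay problem.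
-/

open Complex Filter Topology

namespace Literature.MathematicalPhysics.QuantumFieldTheory

namespace MullerSchiemann1987

namespace HeatKernelStripBound

open HeatKernel (hC betaIV rho1 lemma_iv norm_hC_le_exp_A10 tendsto_betaIV_atTop tendsto_rho1_zero)

/-- `Re z² ≥ −(Im z)²`. [folklore] -/
private theorem neg_im_sq_le_re_sq (z : ℂ) : -(z.im ^ 2) ≤ (z ^ 2).re := by
  simp only [sq, Complex.mul_re]
  nlinarith [mul_self_nonneg z.re]

/-- `β · β^{−2α} = β^{1−2α}` (`β > 0`). [folklore] -/
private theorem mul_rpow_neg_two {β α : ℝ} (hβ : 0 < β) : β * (β ^ (-α)) ^ 2 = β ^ (1 - 2 * α) := by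
  have h2 : (β ^ (-α)) ^ 2 = β ^ (-(2 * α)) := by
    rw [← Real.rpow_natCast, ← Real.rpow_mul hβ.le]; ring_nf
  rw [h2, sub_eq_add_neg, Real.rpow_add hβ, Real.rpow_one]

/-- The eventual thresholds in `γ`: `β = betaIV γ ≥ 1`, `β^{−α} ≤ π/2`, `|ρ₁(γ)| ≤ 1`, and the absorption
`C ≤ ε′(κ/2)²β^{1−2α}`. [cite: MullerSchiemann1987, p.281 L.38 – p.282 L.1 («the small ε′ > 0 absorbs …»)] -/
private theorem eventually_thresholds {α κ ε' C : ℝ} (hα0 : 0 < α) (hα : α < 1 / 2) (hκ0 : 0 < κ) (hε : 0 < ε') :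
    ∀ᶠ γ : ℝ in atTop, 1 ≤ betaIV γ ∧ (betaIV γ) ^ (-α) ≤ Real.pi / 2 ∧ |rho1 γ| ≤ 1 ∧
      C ≤ ε' * (κ / 2) ^ 2 * (betaIV γ) ^ (1 - 2 * α) := by
  have ev1 : ∀ᶠ γ : ℝ in atTop, 1 ≤ betaIV γ := tendsto_betaIV_atTop.eventually (eventually_ge_atTop 1)
  have h0 : Tendsto (fun γ : ℝ => (betaIV γ) ^ (-α)) atTop (𝓝 0) :=
    (tendsto_rpow_neg_atTop hα0).comp tendsto_betaIV_atTop
  have ev2 : ∀ᶠ γ : ℝ in atTop, (betaIV γ) ^ (-α) ≤ Real.pi / 2 :=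
    (h0.eventually (Iic_mem_nhds (by positivity : (0:ℝ) < Real.pi / 2)))
  have ev3a : ∀ᶠ γ : ℝ in atTop, rho1 γ < 1 := tendsto_rho1_zero.eventually (Iio_mem_nhds (by norm_num))
  have ev3b : ∀ᶠ γ : ℝ in atTop, -1 < rho1 γ := tendsto_rho1_zero.eventually (Ioi_mem_nhds (by norm_num))
  have hc : 0 < ε' * (κ / 2) ^ 2 := by positivity
  have h4 : Tendsto (fun γ : ℝ => ε' * (κ / 2) ^ 2 * (betaIV γ) ^ (1 - 2 * α)) atTop atTop :=
    ((tendsto_rpow_atTop (by linarith : (0:ℝ) < 1 - 2 * α)).comp tendsto_betaIV_atTop).const_mul_atTop hc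
  have ev4 : ∀ᶠ γ : ℝ in atTop, C ≤ ε' * (κ / 2) ^ 2 * (betaIV γ) ^ (1 - 2 * α) := h4.eventually (eventually_ge_atTop C)
  filter_upwards [ev1, ev2, ev3a, ev3b, ev4] with γ h1 h2 h3a h3b h4
  exact ⟨h1, h2, abs_le.mpr ⟨h3b.le, h3a.le⟩, h4⟩

/-- **(6.16) FOR THE HEAT-KERNEL ACTION AT THE INITIAL SCALE**: for `0 < α < ½`, `0 < κ`, `κ² < 3/2`, `ε′ > 0` there is
`γ₀` such that for all `γ ≥ γ₀` (`β = betaIV γ`) and all real `x, y` with `|x| ≤ π`, `|y| < (κ/2)β^{−α}`: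
`‖h_HK(x + iy)‖ ≤ exp{(1 + ε′)(κ/2)²β^{1−2α}}` — «It follows from 2), 3) …; the small ε′ > 0 absorbs».
[cite: MullerSchiemann1987, (6.16) p.281; Theorem 2 parts 2)–3) p.281; Appendix Lemma (iv), (A.10) pp.284–285] -/
theorem eq616_heatKernel {α κ ε' : ℝ} (hα0 : 0 < α) (hα : α < 1 / 2) (hκ0 : 0 < κ) (hκ : κ ^ 2 < 3 / 2)
    (hε : 0 < ε') :
    ∃ γ₀ : ℝ, ∀ γ : ℝ, γ₀ ≤ γ → ∀ x y : ℝ, |x| ≤ Real.pi → |y| < κ / 2 * (betaIV γ) ^ (-α) →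
      ‖hC γ ((x : ℂ) + y * I)‖ ≤ Real.exp ((1 + ε') * (κ / 2) ^ 2 * (betaIV γ) ^ (1 - 2 * α)) := by
  obtain ⟨γ₁, hiv⟩ := lemma_iv hα0 hα hκ
  obtain ⟨A, hA⟩ := norm_hC_le_exp_A10 (δ := Real.pi / 2) (by positivity) le_rfl
  obtain ⟨γ₂, hγ₂⟩ := Filter.eventually_atTop.mp
    (eventually_thresholds (C := 7 / 6 * (κ / 2) ^ 2 + A) hα0 hα hκ0 hε)
  refine ⟨max γ₁ (max γ₂ 1), fun γ hγ x y hx hy => ?_⟩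
  have hγ1 : γ₁ ≤ γ := le_trans (le_max_left _ _) hγ
  have hγ2 : γ₂ ≤ γ := le_trans ((le_max_left _ _).trans (le_max_right _ _)) hγ
  have hγone : 1 ≤ γ := le_trans ((le_max_right _ _).trans (le_max_right _ _)) hγ
  obtain ⟨hβ1, hρπ, hrho, habs⟩ := hγ₂ γ hγ2
  set β := betaIV γ with hβ
  have hβ0 : 0 < β := by linarith
  have hρ0 : 0 < β ^ (-α) := Real.rpow_pos_of_pos hβ0 _
  set θ : ℂ := (x : ℂ) + y * I with hθ
  have hre : θ.re = x := by simp [hθ]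
  have him : θ.im = y := by simp [hθ]
  -- `βy² ≤ (κ/2)²β^{1−2α}`
  have hy2 : y ^ 2 ≤ (κ / 2) ^ 2 * (β ^ (-α)) ^ 2 := by
    have h1 : |y| ^ 2 ≤ (κ / 2 * β ^ (-α)) ^ 2 := pow_le_pow_left₀ (abs_nonneg _) hy.le 2
    rw [sq_abs] at h1
    nlinarith
  have hβy : β * y ^ 2 ≤ (κ / 2) ^ 2 * β ^ (1 - 2 * α) := by
    have := mul_le_mul_of_nonneg_left hy2 hβ0.le
    rw [← mul_rpow_neg_two hβ0]; linarith
  have hmain0 : 0 ≤ (κ / 2) ^ 2 * β ^ (1 - 2 * α) := by positivity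
  rcases lt_or_ge (β ^ (-α)) ‖θ‖ with hlarge | hsmall
  · -- large angles: Lemma (iv) = Theorem 2 part 3)
    have h := hiv γ hγ1 θ hlarge (by rw [hre]; exact hx) (by rw [him]; exact hy)
    rw [him] at h
    refine h.le.trans (Real.exp_le_exp.mpr ?_)
    have : 0 ≤ 5 / 8 * β ^ (1 - 2 * α) := by positivity
    have hε0 := mul_nonneg hε.le hmain0
    linarith
  · -- small angles: (A.10) on `ℂ` with `|Re θ| ≤ |θ| ≤ β^{−α} ≤ π/2`
    have hreθ : |θ.re| ≤ Real.pi - Real.pi / 2 := by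
      have := Complex.abs_re_le_norm θ
      linarith
    have h := hA γ hγone θ hreθ
    refine h.trans (Real.exp_le_exp.mpr ?_)
    -- `−γRe θ² ≤ γ y² ≤ (β + 7/6) y²`
    have hγβ : γ = β + 1 / 6 - rho1 γ := by simp only [hβ, HeatKernel.betaIV]; ring
    have hγ0 : 0 ≤ γ := by linarith
    have hr := abs_le.mp hrho
    have hRe : -(γ * (θ ^ 2).re) ≤ γ * y ^ 2 := by
      have := mul_le_mul_of_nonneg_left (neg_im_sq_le_re_sq θ) hγ0
      rw [him] at this; linarith
    have hγy : γ * y ^ 2 ≤ (β + 7 / 6) * y ^ 2 := mul_le_mul_of_nonneg_right (by linarith) (sq_nonneg _)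
    have hρ1 : (β ^ (-α)) ^ 2 ≤ 1 := by
      have h1 : β ^ (-α) ≤ 1 := Real.rpow_le_one_of_one_le_of_nonpos hβ1 (by linarith)
      nlinarith
    have hy2' : y ^ 2 ≤ (κ / 2) ^ 2 := by
      have := mul_le_mul_of_nonneg_left hρ1 (sq_nonneg (κ / 2))
      linarith
    linarith [hRe, hγy, hβy, hy2', habs]

end HeatKernelStripBound

end MullerSchiemann1987

end Literature.MathematicalPhysics.QuantumFieldTheory
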